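/-
Copyright (c) 2026. All rights reserved.
Released under Apache 2.0 license as described in the file LICENSE.
Authors: abc-iut cell, prover seat abc-iut-w5-d038 (gen 8; row «ARC-MTC-F3» (L4-lead m134), part F3b′: the archimedean
`η⊢_{v,ν}` of [AbsTopIII] Cor 5.10 (iv)(c) is compatible with the shell arrow `k∼ ↠ k^×` of `Γ⃗×_arc` (Def 5.4 (v)) —
the `ι`–`η` square abc-iut-L4-t3's `EtaNatural` asks for, at the archimedean places).
-/
import Literature.AnabelianGeometry.AbsoluteAnabelian.ArchimedeanHolGroupPairsEtaTimes
import HarnessLib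

/-!
# The archimedean `η⊢` commutes with `Γ⃗×_arc = (k∼ ↠ k^×)` ([AbsTopIII] Cor 5.10 (iv)(c), Def 5.4 (v), Prop 5.8 (v))

S. Mochizuki, *Topics in absolute anabelian geometry III*: Cor 5.10 (iv)(c) p. 148 compares, naturally in `(𝕏 ↶ k) ∈ 𝒳`,
the `TB⊞`-objects `λ⊞_{v,ν}(𝕏 ↶ k)^{TB⊞}` (Def 5.6 (iv)) with `ψ^{An⊢⊞}_{v,ν}(G_𝕏)` (Prop 5.8 (vii): `k∼(G)`, `k×(G)`),
at EACH vertex `ν` of `Γ⃗×_arc = (k∼ ↠ k^×)` (Def 5.4 (v)); the two vertices are joined on the holomorphic side by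
`ι⊞_× = exp_k : k∼ ↠ k^×` (abc-iut-L4-t8's `HolTFPair.iotaTimesPlus`, «a diagram in TH⊞») and on the mono-analytic side
by `Γ⃗×_arc(G) : k∼(G) ↠ k×(G)` (abc-iut-w6-d025's `TMMono.gammaArc`, the covering `C∼ ↠ C×` times the identity,
Prop 5.8 (v)).  This file proves that abc-iut-w5-d038's `η⊢` at the two vertices (`HolTFPair.etaTilde`, `etaTimes`) form a
COMMUTATIVE SQUARE with these two arrows:

* ★ `HolTFPair.etaTildeIso_hom_gammaArc` — at each `(𝕏 ↶ k)`: `η⊢_× ∘ (exp_k)^{TB⊞} = Γ⃗×_arc(G_𝕏) ∘ η⊢_∼` as morphisms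
  `(k∼)^{TB⊞} → k×(G_𝕏)` of `TB⊞` — on elements `b ∈ k`: both send `b` to `(σ_𝕏 Im e_𝕏(b) mod 2π, c_𝕏 σ_𝕏 Re e_𝕏(b))`,
  because `exp_k(b) = e⁻¹(e^{i Im e(b) + Re e(b)})` (`IsCAF.univCover_eq`);
* ★★ `HolTFPair.etaTilde_hom_gammaArc` — the same as an equation of natural transformations of functors `𝒳 ⥤ TB⊞`:
  `η⊢_∼ ≫ (Γ⃗×_arc whiskered) = ((ι⊞_×)^{TB⊞} whiskered) ≫ η⊢_×`.

PROOF-ONLY (0 definitions); MODEL-LEVEL; nothing here bears on the disputed [IUTchIII] Cor. 3.12; typed ≠ proved.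
-/

set_option autoImplicit false

universe u

open CategoryTheory Complex

namespace Literature.AnabelianGeometry.AbsoluteAnabelian

namespace HolTFPair

variable {𝔄 : AutHolFieldFunctor.{u}}

/-! ## §1. `exp_k` on the parametrisation of `(k^×)^{TB⊞}` -/

/-- **`exp_k(b) = A_{k^×}(Im e(b), Re e(b))`**: the shell arrow lands on the parametrisation `(s, t) ↦ e⁻¹(e^{is + t})` of
`(k^×)^{TB⊞}` at the chart coordinates of `b`. [cite: MochizukiAbsTopIII2015, Definition 5.4 (v) p.127] -/
theorem expHom_eq_paramHom (x : HolTFPair 𝔄) (b : x.k) :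
    expHom x b = (lamTimesPlusObj x).toTBPlusObj.paramHom ((x.cafChart b).im, (x.cafChart b).re) := by
  haveI := x.charZero_k
  apply κ_lamTimesPlusObj_injective x
  rw [κ_paramHom_lamTimesPlusObj, κ_lamTimesPlusObj]
  change x.κ (univCover x.k b) =
    (𝔄.cafChart x.X).symm (Complex.exp (I * ((x.cafChart b).im : ℂ) + ((x.cafChart b).re : ℂ)))
  rw [IsCAF.univCover_eq x.cafChart x.continuous_cafChart_symm b, κ_cafChart_symm, add_comm, mul_comm I, re_add_im]

/-- The `TB⊞`-leg of `ι⊞_×` acts by `exp_k`. [cite: MochizukiAbsTopIII2015, Definition 5.6 (iv) p.136] -/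
theorem toTBPlusMap_iotaTimesPlusApp_toHom (x : HolTFPair 𝔄) (b : x.k) :
    (HolTHPlusPair.toTBPlusMap (P := lamSimPlusObj x) (Q := lamTimesPlusObj x) (iotaTimesPlusApp x)).toHom b =
      expHom x b := rfl

/-! ## §2. The square at one object -/

section Component

variable (c : 𝔄.EA → ℝ) (x : HolTFPair 𝔄) (hc : ∀ X : 𝔄.EA, c X = 1 ∨ c X = -1)
include hc

/-- ★ **`η⊢` commutes with the shell arrow at `(𝕏 ↶ k)`**, on elements: both ways round the square
`(k∼)^{TB⊞} → k×(G_𝕏)` send `b` to `(σ_𝕏 Im e_𝕏(b) mod 2π, c_𝕏 σ_𝕏 Re e_𝕏(b))`.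
[cite: MochizukiAbsTopIII2015, Cor 5.10 (iv)(c) p.148] -/
theorem etaTildeHom_gammaArc_apply (b : ULift.{u + 1} x.k) :
    (TMMono.gammaArc.app (𝔄.toTMMono.obj x.X)).toHom (etaTildeHom c x b) =
      (etaTimesIso c x hc).hom.toHom ((TBPlus.uliftHom.{u + 1}
        (HolTHPlusPair.toTBPlusMap (P := lamSimPlusObj x) (Q := lamTimesPlusObj x) (iotaTimesPlusApp x))).toHom b) := by
  rw [TMMono.gammaArc_app_toHom_apply, etaTildeHom_apply, TBPlus.uliftHom_toHom_apply,
    toTBPlusMap_iotaTimesPlusApp_toHom, expHom_eq_paramHom, ← uliftObj_paramHom_apply,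
    etaTimesIso_hom_toHom_paramHom, TMMono.kTimesObj_paramHom_apply, TBPlus.diag_apply]

/-- ★ **The `ι`–`η` square at `(𝕏 ↶ k)` in `TB⊞`**: `η⊢_∼(𝕏) ≫ Γ⃗×_arc(G_𝕏) = (ι⊞_×(𝕏))^{TB⊞} ≫ η⊢_×(𝕏)`.
[cite: MochizukiAbsTopIII2015, Cor 5.10 (iv)(c) p.148] -/
theorem etaTildeIso_hom_gammaArc :
    (etaTildeIso c x hc).hom ≫ TMMono.gammaArc.app (𝔄.toTMMono.obj x.X) =
      TBPlus.uliftHom.{u + 1} (HolTHPlusPair.toTBPlusMap (P := lamSimPlusObj x) (Q := lamTimesPlusObj x)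
        (iotaTimesPlusApp x)) ≫ (etaTimesIso c x hc).hom :=
  TBPlus.hom_ext_toHom (ContinuousAddMonoidHom.ext fun b => etaTildeHom_gammaArc_apply c x hc b)

end Component

/-! ## §3. The square of natural transformations -/

section Natural

variable (𝔄)
variable (c : 𝔄.EA → ℝ) (hc : ∀ X : 𝔄.EA, c X = 1 ∨ c X = -1)
  (hcob : ∀ {X Y : 𝔄.EA} (f : X ⟶ Y), AutHolFieldFunctor.transitionSign f = c X * c Y)
include hc hcob

/-- ★★ **`η⊢` is compatible with `Γ⃗×_arc`** (the `ι`–`η` square of functors `𝒳 ⥤ TB⊞`):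
`η⊢_∼ ≫ (G ↦ Γ⃗×_arc(G)) = (ι⊞_×)^{TB⊞} ≫ η⊢_×`. [cite: MochizukiAbsTopIII2015, Cor 5.10 (iv)(c) p.148] -/
theorem etaTilde_hom_gammaArc :
    (etaTilde 𝔄 c hc hcob).hom ≫ Functor.whiskerLeft (toEA 𝔄 ⋙ 𝔄.toTMMono) TMMono.gammaArc =
      Functor.whiskerRight (Functor.whiskerRight (iotaTimesPlus 𝔄) (HolTHPlusPair.toTBPlus 𝔄))
          TBPlus.uliftFunctor.{u + 1} ≫ (etaTimes 𝔄 c hc hcob).hom := by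
  ext x : 2
  exact etaTildeIso_hom_gammaArc c x hc

/-- The same square, componentwise, in the functor packaging. [cite: MochizukiAbsTopIII2015, Cor 5.10 (iv)(c) p.148] -/
theorem etaTilde_hom_app_gammaArc (x : HolTFPair 𝔄) :
    (etaTilde 𝔄 c hc hcob).hom.app x ≫ TMMono.gammaArc.app (𝔄.toTMMono.obj x.X) =
      TBPlus.uliftFunctor.{u + 1}.map ((HolTHPlusPair.toTBPlus 𝔄).map ((iotaTimesPlus 𝔄).app x)) ≫
        (etaTimes 𝔄 c hc hcob).hom.app x :=
  etaTildeIso_hom_gammaArc c x hc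

end Natural

/-- **Existence form**: under an orientation cochain there are `η⊢_∼`, `η⊢_×` forming a commutative square with the shell
arrows. [cite: MochizukiAbsTopIII2015, Cor 5.10 (iv)(c) p.148] -/
theorem exists_eta_square_of_cochain (𝔄 : AutHolFieldFunctor.{u})
    (h : ∃ c : 𝔄.EA → ℝ, (∀ X, c X = 1 ∨ c X = -1) ∧
      ∀ {X Y : 𝔄.EA} (f : X ⟶ Y), AutHolFieldFunctor.transitionSign f = c X * c Y) :
    ∃ (η₁ : lamSimPlus 𝔄 ⋙ HolTHPlusPair.toTBPlus 𝔄 ⋙ TBPlus.uliftFunctor.{u + 1} ≅ toEA 𝔄 ⋙ 𝔄.toTMMono ⋙ TMMono.kTilde)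
      (η₂ : lamTimesPlus 𝔄 ⋙ HolTHPlusPair.toTBPlus 𝔄 ⋙ TBPlus.uliftFunctor.{u + 1} ≅ toEA 𝔄 ⋙ 𝔄.toTMMono ⋙ TMMono.kTimes),
      η₁.hom ≫ Functor.whiskerLeft (toEA 𝔄 ⋙ 𝔄.toTMMono) TMMono.gammaArc =
        Functor.whiskerRight (Functor.whiskerRight (iotaTimesPlus 𝔄) (HolTHPlusPair.toTBPlus 𝔄))
          TBPlus.uliftFunctor.{u + 1} ≫ η₂.hom := by
  obtain ⟨c, hc, hcob⟩ := h
  exact ⟨etaTilde 𝔄 c hc hcob, etaTimes 𝔄 c hc hcob, etaTilde_hom_gammaArc 𝔄 c hc hcob⟩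

end HolTFPair

namespace HolRS

/-- ★★ **At the geometric Aut-holomorphic field functor the whole archimedean `Γ⃗×_arc`-compatible `η⊢` exists
unconditionally.** [cite: MochizukiAbsTopIII2015, Cor 5.10 (iv)(c) p.148] -/
theorem exists_eta_square_geometric (Q : ObjectProperty HolRS) :
    ∃ (η₁ : HolTFPair.lamSimPlus (geometricAutHolFieldFunctor Q) ⋙ HolTHPlusPair.toTBPlus (geometricAutHolFieldFunctor Q) ⋙
        TBPlus.uliftFunctor.{1} ≅ HolTFPair.toEA (geometricAutHolFieldFunctor Q) ⋙
          (geometricAutHolFieldFunctor Q).toTMMono ⋙ TMMono.kTilde)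
      (η₂ : HolTFPair.lamTimesPlus (geometricAutHolFieldFunctor Q) ⋙
        HolTHPlusPair.toTBPlus (geometricAutHolFieldFunctor Q) ⋙ TBPlus.uliftFunctor.{1} ≅
          HolTFPair.toEA (geometricAutHolFieldFunctor Q) ⋙ (geometricAutHolFieldFunctor Q).toTMMono ⋙ TMMono.kTimes),
      η₁.hom ≫ Functor.whiskerLeft (HolTFPair.toEA (geometricAutHolFieldFunctor Q) ⋙
          (geometricAutHolFieldFunctor Q).toTMMono) TMMono.gammaArc =
        Functor.whiskerRight (Functor.whiskerRight (HolTFPair.iotaTimesPlus (geometricAutHolFieldFunctor Q))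
          (HolTHPlusPair.toTBPlus (geometricAutHolFieldFunctor Q))) TBPlus.uliftFunctor.{1} ≫ η₂.hom :=
  HolTFPair.exists_eta_square_of_cochain _ (exists_orientationCochain_geometric Q)

end HolRS

end Literature.AnabelianGeometry.AbsoluteAnabelian
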